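import Summits.AtomisticToContinuum.FouriersLaw.Theorems.PhononMeanFreePathDefs
import Summits.AtomisticToContinuum.FouriersLaw.Theorems.PhononMeanFreePathIncoherentBoundedCorrelationDecay

/-!
# `IncoherentChannel`, line `two-horizons-forecast-loss` — the fixed-`N` half of `stub_varianceTransport`

Helper file for the registered stub `stub_varianceTransport` of crux `PhononMeanFreePath.IncoherentChannel`
(item stmt-AtomisticToContinuum-11811, route `PhononMeanFreePath`, sub-problem `FouriersLaw`), in the vocabulary
of `PhononMeanFreePathDefs` (`fcast`, `fnorm`, `commonPast`, `powerCov`, `varianceChannel`): for the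
`(N+1)`-site pinned anharmonic chain `pinnedChain ω₂ lam β γ` with both Langevin baths at temperature `T`
(`μ₀ = gibbsMeasure (N+1) T`, `K_t = transitionKernel (N+1) T T t`, the CONSTRUCTED objects), the stub asks for
`B_N = varianceChannel … N ∈ L¹(0,∞)` for every `N` AND for the transport limit `N(γ²/T²)∫₀^∞ B_N → κ > 0`.

This file proves the FIXED-`N` HALF and the fixed-`N` structure, from the exponential ergodicity of the
equilibrium chain PROVED in the tree (Cuneo–Eckmann–Hairer–Rey-Bellet 2018, Thm 2.13 (3):
`pinnedChainSemigroup_ergodic`, with the limit identified with `μ₀` in `pinnedChain_exp_convergence_gibbs`):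

* `varianceTransport_fcast_abs_le_exp` — pointwise exponential loss of the mean forecast of the far momentum,
  `|v_t(z)| = |K_t p_N(z)| ≤ A e^{ϑH(z)} e^{-ct}` (`∫ p_N dμ₀ = 0`);
* `fnorm_le_exp` — `S_N(t) = ‖K_t p_N‖²_{L²(μ₀)} ≤ A_N e^{-c_N t}`: the fixed-`N`, exponential shadow of the line's
  `N`-uniform engine `stub_forecastLoss`;
* `commonPast_abs_le_exp`, `powerCov_abs_le_exp`, `varianceTransport_abs_le_exp` — `|P_N(t)|, |C_N(t)|, |B_N(t)|`
  decay exponentially at every `N`;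
* `varianceTransport_measurable_fnorm`, `varianceTransport_measurable_commonPast`,
  `varianceTransport_measurable_powerCov` — measurability in `t` (joint measurability of the constructed kernels);
* `powerCov_integrableOn` — `C_N ∈ L¹(0,∞)` for every `N`: in substance the integrability conjunct of the sibling
  crux `BoundaryKubo` (stmt-AtomisticToContinuum-11812); `commonPast_integrableOn`; and
  `varianceTransport_integrableOn` — **the first conjunct of `stub_varianceTransport`, for every `N`**;
* `varianceTransport_of_limit` — hence the stub is equivalent to its limit clause alone.

All constants `A_N, c_N` come from Harris' theorem and DEPEND ON `N`; nothing here is uniform in `N`, and the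
limit clause (Fourier's law for the pinned anharmonic chain in variance clothing, an open problem) is not
touched. No definitions.

## References

* N. Cuneo, J.-P. Eckmann, M. Hairer, L. Rey-Bellet, *Non-equilibrium steady states for networks of
  oscillators*, Electron. J. Probab. 23 (2018) no. 55, Thm 2.13 (3).
-/

noncomputable section

namespace Summit.AtomisticToContinuum.FouriersLaw.Theorems.PhononMeanFreePath

open MeasureTheory ProbabilityTheory Set Filter Topology
open scoped NNReal ENNReal
open Literature.MathematicalPhysics.KineticTheory.HeatConduction
open Literature.MathematicalPhysics.KineticTheory Literature.Probability.Process OscillatorChain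
open Summit.AtomisticToContinuum.FouriersLaw.Theorems.SubdiffusiveBondHeat
open Summit.AtomisticToContinuum.FouriersLaw.Theorems.IncoherentBounded

section FixedN

variable {ω₂ lam β γ T : ℝ}

/-- `(e^x)² = e^{2x}`. [folklore] -/
private theorem exp_sq_eq (x : ℝ) : Real.exp x ^ 2 = Real.exp (2 * x) := by
  rw [sq, ← Real.exp_add]
  ring_nf

/-- **Joint measurability of the mean forecast**: `(t, z) ↦ v_t(z) = (K_{t⁺} p_N)(z)` is strongly measurable
(the constructed kernels are jointly measurable in `(t, z)`, `pinnedChain_measurable_transitionKernel`, and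
kernel integrals of a measurable integrand are measurable in the parameter). [folklore] -/
theorem varianceTransport_stronglyMeasurable_fcast (hω : 0 < ω₂) (hl : 0 ≤ lam) (hβ : 0 ≤ β) (hγ : 0 ≤ γ)
    (N : ℕ) : StronglyMeasurable fun q : ℝ × PhaseSpace (N + 1) => fcast ω₂ lam β γ T N q.1 q.2 := by
  unfold fcast
  -- NB: abstract the chain first (unifying against the unfolded `pinnedChain` flow times out)
  set P := pinnedChain ω₂ lam β γ with hP
  -- the kernels as ONE kernel on `ℝ≥0 × Ω`
  let κ₂ : Kernel (ℝ≥0 × PhaseSpace (N + 1)) (PhaseSpace (N + 1)) :=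
    { toFun := fun p => P.transitionKernel (N + 1) T T p.1 p.2
      measurable' := pinnedChain_measurable_transitionKernel hω hl hβ hγ (N + 1) T T }
  have hg : Continuous fun y : PhaseSpace (N + 1) => y.2 (Fin.last N) := by fun_prop
  have hG : StronglyMeasurable fun p : ℝ≥0 × PhaseSpace (N + 1) => ∫ y, y.2 (Fin.last N) ∂(κ₂ p) :=
    hg.stronglyMeasurable.integral_kernel (κ := κ₂)
  have h2 : StronglyMeasurable fun q : ℝ × PhaseSpace (N + 1) =>
      ∫ y, y.2 (Fin.last N) ∂(κ₂ (q.1.toNNReal, q.2)) :=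
    hG.comp_measurable ((measurable_real_toNNReal.comp measurable_fst).prodMk measurable_snd)
  exact h2

/-- **Measurability of the forecast norm** `t ↦ S_N(t) = ∫ v_t² dμ₀` (Fubini-measurability of a jointly
measurable integrand against the probability measure `μ₀`). [folklore] -/
theorem varianceTransport_measurable_fnorm (hω : 0 < ω₂) (hl : 0 ≤ lam) (hβ : 0 ≤ β) (hγ : 0 ≤ γ)
    (hT : 0 < T) (N : ℕ) : Measurable (fnorm ω₂ lam β γ T N) := by
  haveI : IsProbabilityMeasure ((pinnedChain ω₂ lam β γ).gibbsMeasure (N + 1) T) :=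
    pinnedChain_isProbabilityMeasure_gibbsMeasure hω hl hβ γ (N + 1) hT
  have hF := varianceTransport_stronglyMeasurable_fcast (T := T) hω hl hβ hγ N
  have hF2 : StronglyMeasurable fun q : ℝ × PhaseSpace (N + 1) => (fcast ω₂ lam β γ T N q.1 q.2) ^ 2 :=
    (hF.measurable.pow_const 2).stronglyMeasurable
  exact (hF2.integral_prod_right' (ν := (pinnedChain ω₂ lam β γ).gibbsMeasure (N + 1) T)).measurable

/-- **Measurability of the common-past part** `t ↦ P_N(t) = ∫ p₀² v_t² dμ₀ - (∫ p₀² dμ₀)(∫ v_t² dμ₀)`.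
[folklore] -/
theorem varianceTransport_measurable_commonPast (hω : 0 < ω₂) (hl : 0 ≤ lam) (hβ : 0 ≤ β) (hγ : 0 ≤ γ)
    (hT : 0 < T) (N : ℕ) : Measurable (commonPast ω₂ lam β γ T N) := by
  haveI : IsProbabilityMeasure ((pinnedChain ω₂ lam β γ).gibbsMeasure (N + 1) T) :=
    pinnedChain_isProbabilityMeasure_gibbsMeasure hω hl hβ γ (N + 1) hT
  have hF := varianceTransport_stronglyMeasurable_fcast (T := T) hω hl hβ hγ N
  have hq : Measurable fun q : ℝ × PhaseSpace (N + 1) => (q.2.2 0) ^ 2 :=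
    (by fun_prop : Continuous fun q : ℝ × PhaseSpace (N + 1) => (q.2.2 0) ^ 2).measurable
  have hF2 : StronglyMeasurable fun q : ℝ × PhaseSpace (N + 1) =>
      (q.2.2 0) ^ 2 * (fcast ω₂ lam β γ T N q.1 q.2) ^ 2 :=
    (hq.mul (hF.measurable.pow_const 2)).stronglyMeasurable
  have h1 : Measurable fun t : ℝ => ∫ z, (z.2 0) ^ 2 * (fcast ω₂ lam β γ T N t z) ^ 2
      ∂((pinnedChain ω₂ lam β γ).gibbsMeasure (N + 1) T) :=
    (hF2.integral_prod_right' (ν := (pinnedChain ω₂ lam β γ).gibbsMeasure (N + 1) T)).measurable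
  have h2 := varianceTransport_measurable_fnorm hω hl hβ hγ hT N
  exact h1.sub (h2.const_mul _)

/-- **Measurability of the power covariance** `t ↦ C_N(t)` (a restatement, in the vocabulary of
`PhononMeanFreePathDefs`, of `IncoherentBounded.measurable_CN`). [folklore] -/
theorem varianceTransport_measurable_powerCov (hω : 0 < ω₂) (hl : 0 ≤ lam) (hβ : 0 < β) (hγ : 0 < γ)
    (hT : 0 < T) (N : ℕ) : Measurable (powerCov ω₂ lam β γ T N) :=
  measurable_CN hω hl hβ hγ hT N

/-- **Pointwise exponential loss of the mean forecast at fixed size.** For `0 < ϑ < 1/T` there are `A, c > 0`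
(depending on `N`) with `|v_t(z)| = |(K_t p_N)(z)| ≤ A e^{ϑH(z)} e^{-ct}` for all `z` and `t ≥ 0`: CEHR (2.5) with
the limit identified with `μ₀` (`pinnedChain_exp_convergence_gibbs`) applied to `f = p_N / (1/2 + 1/ϑ)`,
`|f| ≤ e^{ϑH}`, together with `∫ p_N dμ₀ = 0`. [cite: CuneoEckmannHairerReyBellet2018, Thm 2.13 (3)] -/
theorem varianceTransport_fcast_abs_le_exp (hω : 0 < ω₂) (hl : 0 ≤ lam) (hβ : 0 < β) (hγ : 0 < γ)
    (hT : 0 < T) (N : ℕ) {ϑ : ℝ} (hϑ0 : 0 < ϑ) (hϑ1 : ϑ < 1 / T) :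
    ∃ A c : ℝ, 0 < A ∧ 0 < c ∧ ∀ t : ℝ, 0 ≤ t → ∀ z : PhaseSpace (N + 1),
      |fcast ω₂ lam β γ T N t z| ≤
        A * Real.exp (ϑ * (pinnedChain ω₂ lam β γ).hamiltonian (N + 1) z) * Real.exp (-c * t) := by
  obtain ⟨C₀, c, hC₀, hc, hconv⟩ :=
    pinnedChain_exp_convergence_gibbs hω hl hβ hγ (Nat.succ_pos N) hT hϑ0 hϑ1
  set B : ℝ := 1 / 2 + 1 / ϑ with hB
  have hB0 : 0 < B := by positivity
  refine ⟨B * C₀, c, by positivity, hc, fun t ht z => ?_⟩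
  have hf : Continuous fun y : PhaseSpace (N + 1) => B⁻¹ * y.2 (Fin.last N) := by fun_prop
  have hfb : ∀ y : PhaseSpace (N + 1), |B⁻¹ * y.2 (Fin.last N)| ≤
      Real.exp (ϑ * (pinnedChain ω₂ lam β γ).hamiltonian (N + 1) y) := fun y => by
    rw [abs_mul, abs_of_pos (inv_pos.2 hB0), inv_mul_le_iff₀ hB0]
    exact abs_momentum_le_exp hω hl hβ.le hϑ0 y (Fin.last N)
  have h := hconv z t.toNNReal _ hf hfb
  rw [integral_const_mul, integral_const_mul, integral_momentum_gibbsMeasure ω₂ lam β γ (N + 1) T (Fin.last N),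
    mul_zero, sub_zero, abs_mul, abs_of_pos (inv_pos.2 hB0), inv_mul_le_iff₀ hB0, Real.coe_toNNReal _ ht] at h
  calc |fcast ω₂ lam β γ T N t z|
      ≤ B * (C₀ * Real.exp (ϑ * (pinnedChain ω₂ lam β γ).hamiltonian (N + 1) z) * Real.exp (-c * t)) := h
    _ = B * C₀ * Real.exp (ϑ * (pinnedChain ω₂ lam β γ).hamiltonian (N + 1) z) * Real.exp (-c * t) := by ring

/-- **The fixed-`N` exponential bounds on everything routed through the mean forecast.** There are `A, c > 0`
(depending on `N`) such that for all `t ≥ 0`: `S_N(t) ≤ A e^{-ct}`, `∫ p₀² v_t² dμ₀ ≤ A e^{-ct}` and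
`|P_N(t)| ≤ A e^{-ct}` — square the pointwise bound `|v_t| ≤ A' e^{H/(8T)} e^{-c't}`, use
`p₀² ≤ 8T e^{H/(4T)}` and integrate the weight `e^{H/(2T)} ∈ L¹(μ₀)`.
[cite: CuneoEckmannHairerReyBellet2018, Thm 2.13 (3)] -/
theorem varianceTransport_meanForecast_bounds (hω : 0 < ω₂) (hl : 0 ≤ lam) (hβ : 0 < β) (hγ : 0 < γ)
    (hT : 0 < T) (N : ℕ) :
    ∃ A c : ℝ, 0 < A ∧ 0 < c ∧ ∀ t : ℝ, 0 ≤ t →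
      fnorm ω₂ lam β γ T N t ≤ A * Real.exp (-c * t) ∧
      (∫ z, (z.2 0) ^ 2 * (fcast ω₂ lam β γ T N t z) ^ 2 ∂((pinnedChain ω₂ lam β γ).gibbsMeasure (N + 1) T))
          ≤ A * Real.exp (-c * t) ∧
      |commonPast ω₂ lam β γ T N t| ≤ A * Real.exp (-c * t) := by
  set P := pinnedChain ω₂ lam β γ with hP
  set μ := P.gibbsMeasure (N + 1) T with hμ
  haveI : IsProbabilityMeasure μ := pinnedChain_isProbabilityMeasure_gibbsMeasure hω hl hβ.le γ (N + 1) hT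
  -- exponents: `ϑ = 1/(8T)` for the forecast, `δ = 1/(4T)` for `p₀²`, total weight `2ϑ + δ = 1/(2T)`
  have hϑ0 : (0 : ℝ) < 1 / (8 * T) := by positivity
  have hϑ1 : 1 / (8 * T) < 1 / T := by
    rw [div_lt_div_iff₀ (by positivity) hT]; nlinarith
  have hδ0 : (0 : ℝ) < 1 / (4 * T) := by positivity
  have hs : 2 * (1 / (8 * T)) + 1 / (4 * T) = 1 / (2 * T) := by field_simp; ring
  have hs' : 2 * (1 / (8 * T)) ≤ 1 / (2 * T) := by rw [← hs]; linarith
  have hs1 : 1 / (2 * T) < 1 / T := by rw [div_lt_div_iff₀ (by positivity) hT]; nlinarith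
  obtain ⟨A, c, hA, hc, hb⟩ := varianceTransport_fcast_abs_le_exp hω hl hβ hγ hT N hϑ0 hϑ1
  -- the weight `e^{H/(2T)}` and the static second moment `∫ p₀² dμ₀`
  have hWint : Integrable (fun z => Real.exp (1 / (2 * T) * P.hamiltonian (N + 1) z)) μ :=
    pinnedChain_integrable_exp_mul_hamiltonian_gibbsMeasure hω hl hβ.le γ (N + 1) hT hs1
  set W : ℝ := ∫ z, Real.exp (1 / (2 * T) * P.hamiltonian (N + 1) z) ∂μ with hW
  have hW0 : 0 < W := integral_exp_pos hWint
  set P₀ : ℝ := ∫ z : PhaseSpace (N + 1), (z.2 0) ^ 2 ∂μ with hP₀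
  have hP₀0 : 0 ≤ P₀ := integral_nonneg fun z => sq_nonneg _
  have hAW : 0 < A ^ 2 * W := by positivity
  refine ⟨(8 * T + 1 + P₀) * (A ^ 2 * W), 2 * c, by positivity, by positivity, fun t ht => ?_⟩
  have hH0 : ∀ z, 0 ≤ P.hamiltonian (N + 1) z := fun z =>
    pinnedChain_hamiltonian_nonneg hω.le hl hβ.le γ (N + 1) z
  have hE2 : Real.exp (-(2 * c) * t) = Real.exp (-c * t) ^ 2 := by
    rw [exp_sq_eq]; congr 1; ring
  -- pointwise: `v² ≤ A² e^{-2ct} e^{H/(2T)}` and `p₀² v² ≤ 8T A² e^{-2ct} e^{H/(2T)}`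
  have hv2 : ∀ z, (fcast ω₂ lam β γ T N t z) ^ 2 ≤
      A ^ 2 * Real.exp (-c * t) ^ 2 * Real.exp (1 / (2 * T) * P.hamiltonian (N + 1) z) := by
    intro z
    have h2 : (fcast ω₂ lam β γ T N t z) ^ 2 ≤
        (A * Real.exp (1 / (8 * T) * P.hamiltonian (N + 1) z) * Real.exp (-c * t)) ^ 2 := by
      rw [← sq_abs]; exact pow_le_pow_left₀ (abs_nonneg _) (hb t ht z) 2
    have h3 : Real.exp (1 / (8 * T) * P.hamiltonian (N + 1) z) ^ 2 ≤
        Real.exp (1 / (2 * T) * P.hamiltonian (N + 1) z) := by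
      rw [exp_sq_eq, Real.exp_le_exp, ← mul_assoc]
      exact mul_le_mul_of_nonneg_right hs' (hH0 z)
    calc _ ≤ (A * Real.exp (1 / (8 * T) * P.hamiltonian (N + 1) z) * Real.exp (-c * t)) ^ 2 := h2
      _ = A ^ 2 * Real.exp (-c * t) ^ 2 * Real.exp (1 / (8 * T) * P.hamiltonian (N + 1) z) ^ 2 := by ring
      _ ≤ A ^ 2 * Real.exp (-c * t) ^ 2 * Real.exp (1 / (2 * T) * P.hamiltonian (N + 1) z) := by gcongr
  have hp2v2 : ∀ z : PhaseSpace (N + 1), (z.2 0) ^ 2 * (fcast ω₂ lam β γ T N t z) ^ 2 ≤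
      8 * T * A ^ 2 * Real.exp (-c * t) ^ 2 * Real.exp (1 / (2 * T) * P.hamiltonian (N + 1) z) := by
    intro z
    have h2 : (fcast ω₂ lam β γ T N t z) ^ 2 ≤
        (A * Real.exp (1 / (8 * T) * P.hamiltonian (N + 1) z) * Real.exp (-c * t)) ^ 2 := by
      rw [← sq_abs]; exact pow_le_pow_left₀ (abs_nonneg _) (hb t ht z) 2
    have hp : (z.2 0) ^ 2 ≤ (2 / (1 / (4 * T))) * Real.exp (1 / (4 * T) * P.hamiltonian (N + 1) z) :=
      sq_momentum_le_exp hω hl hβ.le hδ0 z 0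
    have h2δ : 2 / (1 / (4 * T)) = 8 * T := by field_simp; ring
    have hexp : Real.exp (1 / (4 * T) * P.hamiltonian (N + 1) z) *
        Real.exp (1 / (8 * T) * P.hamiltonian (N + 1) z) ^ 2 =
          Real.exp (1 / (2 * T) * P.hamiltonian (N + 1) z) := by
      rw [exp_sq_eq, ← Real.exp_add, ← hs]; congr 1; ring
    calc (z.2 0) ^ 2 * (fcast ω₂ lam β γ T N t z) ^ 2
        ≤ ((2 / (1 / (4 * T))) * Real.exp (1 / (4 * T) * P.hamiltonian (N + 1) z)) *
            (A * Real.exp (1 / (8 * T) * P.hamiltonian (N + 1) z) * Real.exp (-c * t)) ^ 2 :=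
          mul_le_mul hp h2 (sq_nonneg _) (by positivity)
      _ = (2 / (1 / (4 * T))) * A ^ 2 * Real.exp (-c * t) ^ 2 *
            (Real.exp (1 / (4 * T) * P.hamiltonian (N + 1) z) *
              Real.exp (1 / (8 * T) * P.hamiltonian (N + 1) z) ^ 2) := by ring
      _ = 8 * T * A ^ 2 * Real.exp (-c * t) ^ 2 * Real.exp (1 / (2 * T) * P.hamiltonian (N + 1) z) := by
          rw [hexp, h2δ]
  -- integrate the two pointwise bounds
  have hfn : fnorm ω₂ lam β γ T N t ≤ A ^ 2 * W * Real.exp (-c * t) ^ 2 := by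
    have h := integral_mono_of_nonneg (μ := μ)
      (Eventually.of_forall fun z => sq_nonneg (fcast ω₂ lam β γ T N t z))
      (hWint.const_mul (A ^ 2 * Real.exp (-c * t) ^ 2)) (Eventually.of_forall hv2)
    rw [integral_const_mul] at h
    calc fnorm ω₂ lam β γ T N t = ∫ z, (fcast ω₂ lam β γ T N t z) ^ 2 ∂μ := rfl
      _ ≤ A ^ 2 * Real.exp (-c * t) ^ 2 * W := h
      _ = A ^ 2 * W * Real.exp (-c * t) ^ 2 := by ring
  have hpv : (∫ z, (z.2 0) ^ 2 * (fcast ω₂ lam β γ T N t z) ^ 2 ∂μ) ≤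
      8 * T * (A ^ 2 * W) * Real.exp (-c * t) ^ 2 := by
    have h := integral_mono_of_nonneg (μ := μ)
      (Eventually.of_forall fun z : PhaseSpace (N + 1) =>
        mul_nonneg (sq_nonneg (z.2 0)) (sq_nonneg (fcast ω₂ lam β γ T N t z)))
      (hWint.const_mul (8 * T * A ^ 2 * Real.exp (-c * t) ^ 2)) (Eventually.of_forall hp2v2)
    rw [integral_const_mul] at h
    calc _ ≤ 8 * T * A ^ 2 * Real.exp (-c * t) ^ 2 * W := h
      _ = 8 * T * (A ^ 2 * W) * Real.exp (-c * t) ^ 2 := by ring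
  have hfn0 : 0 ≤ fnorm ω₂ lam β γ T N t := fnorm_nonneg ω₂ lam β γ T N t
  have hpv0 : 0 ≤ ∫ z, (z.2 0) ^ 2 * (fcast ω₂ lam β γ T N t z) ^ 2 ∂μ :=
    integral_nonneg fun z => mul_nonneg (sq_nonneg _) (sq_nonneg _)
  have hE0 : 0 ≤ Real.exp (-c * t) ^ 2 := sq_nonneg _
  have hX : 0 ≤ A ^ 2 * W * Real.exp (-c * t) ^ 2 := by positivity
  have hcp : |commonPast ω₂ lam β γ T N t| ≤ (8 * T + P₀) * (A ^ 2 * W) * Real.exp (-c * t) ^ 2 := by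
    have e : commonPast ω₂ lam β γ T N t =
        (∫ z, (z.2 0) ^ 2 * (fcast ω₂ lam β γ T N t z) ^ 2 ∂μ) - P₀ * fnorm ω₂ lam β γ T N t := rfl
    have hPS : P₀ * fnorm ω₂ lam β γ T N t ≤ P₀ * (A ^ 2 * W * Real.exp (-c * t) ^ 2) :=
      mul_le_mul_of_nonneg_left hfn hP₀0
    have hPS0 : 0 ≤ P₀ * fnorm ω₂ lam β γ T N t := mul_nonneg hP₀0 hfn0
    rw [e, abs_le]
    constructor
    · nlinarith
    · nlinarith
  rw [hE2]
  refine ⟨hfn.trans ?_, hpv.trans ?_, hcp.trans ?_⟩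
  · apply mul_le_mul_of_nonneg_right _ hE0
    nlinarith
  · apply mul_le_mul_of_nonneg_right _ hE0
    nlinarith
  · apply mul_le_mul_of_nonneg_right _ hE0
    nlinarith

end FixedN

/-! ### The registered helper statements (all parameters `> 0`, as in the stub) -/

/-- **Fixed-`N` exponential forecast loss**: for all parameters `> 0`, `T > 0` and every `N` there are
`A, c > 0` — depending on `N` (Harris constants) — with `S_N(t) = ‖K_t p_N‖²_{L²(μ₀)} ≤ A e^{-ct}` for all
`t ≥ 0`. This is the fixed-`N` shadow of the line's engine `stub_forecastLoss` (which asks for an `N`-UNIFORM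
polynomial envelope); registered helper for `stub_varianceTransport`.
[cite: CuneoEckmannHairerReyBellet2018, Thm 2.13 (3)] -/
theorem fnorm_le_exp : ∀ ω₂ lam β γ : ℝ, 0 < ω₂ → 0 < lam → 0 < β → 0 < γ → ∀ T : ℝ, 0 < T → ∀ N : ℕ, ∃ A c : ℝ, 0 < A ∧ 0 < c ∧ ∀ t : ℝ, 0 ≤ t → fnorm ω₂ lam β γ T N t ≤ A * Real.exp (-c * t) := by
  intro ω₂ lam β γ hω hl hβ hγ T hT N
  obtain ⟨A, c, hA, hc, h⟩ := varianceTransport_meanForecast_bounds hω hl.le hβ hγ hT N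
  exact ⟨A, c, hA, hc, fun t ht => (h t ht).1⟩

/-- **Fixed-`N` exponential decay of the common-past part**: for all parameters `> 0`, `T > 0` and every `N`
there are `A, c > 0` (depending on `N`) with `|P_N(t)| = |Cov_{μ₀}(p₀², v_t²)| ≤ A e^{-ct}` for all `t ≥ 0`.
Registered helper for `stub_varianceTransport`. [cite: CuneoEckmannHairerReyBellet2018, Thm 2.13 (3)] -/
theorem commonPast_abs_le_exp : ∀ ω₂ lam β γ : ℝ, 0 < ω₂ → 0 < lam → 0 < β → 0 < γ → ∀ T : ℝ, 0 < T → ∀ N : ℕ, ∃ A c : ℝ, 0 < A ∧ 0 < c ∧ ∀ t : ℝ, 0 ≤ t → |commonPast ω₂ lam β γ T N t| ≤ A * Real.exp (-c * t) := by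
  intro ω₂ lam β γ hω hl hβ hγ T hT N
  obtain ⟨A, c, hA, hc, h⟩ := varianceTransport_meanForecast_bounds hω hl.le hβ hγ hT N
  exact ⟨A, c, hA, hc, fun t ht => (h t ht).2.2⟩

/-- **Fixed-`N` exponential decay of the power covariance**: for all parameters `> 0`, `T > 0` and every `N`
there are `A, c > 0` (depending on `N`) with `|C_N(t)| = |Cov_{μ₀}(p₀², K_t p_N²)| ≤ A e^{-ct}` for all `t ≥ 0`
(`IncoherentBounded.CN_exp_decay` in the vocabulary of `PhononMeanFreePathDefs`). Registered helper for
`stub_varianceTransport`. [cite: CuneoEckmannHairerReyBellet2018, Thm 2.13 (3)] -/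
theorem powerCov_abs_le_exp : ∀ ω₂ lam β γ : ℝ, 0 < ω₂ → 0 < lam → 0 < β → 0 < γ → ∀ T : ℝ, 0 < T → ∀ N : ℕ, ∃ A c : ℝ, 0 < A ∧ 0 < c ∧ ∀ t : ℝ, 0 ≤ t → |powerCov ω₂ lam β γ T N t| ≤ A * Real.exp (-c * t) := by
  intro ω₂ lam β γ hω hl hβ hγ T hT N
  obtain ⟨C, c, hc, h⟩ := CN_exp_decay hω hl.le hβ hγ hT N
  refine ⟨|C| + 1, c, by positivity, hc, fun t ht => (h t ht).trans ?_⟩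
  exact mul_le_mul_of_nonneg_right ((le_abs_self C).trans (by linarith)) (Real.exp_pos _).le

/-- **Fixed-`N` exponential decay of the variance channel**: for all parameters `> 0`, `T > 0` and every `N`
there are `A, c > 0` (depending on `N`) with `|B_N(t)| = |C_N(t) - P_N(t)| ≤ A e^{-ct}` for all `t ≥ 0`.
Registered helper for `stub_varianceTransport`. [cite: CuneoEckmannHairerReyBellet2018, Thm 2.13 (3)] -/
theorem varianceTransport_abs_le_exp : ∀ ω₂ lam β γ : ℝ, 0 < ω₂ → 0 < lam → 0 < β → 0 < γ → ∀ T : ℝ, 0 < T → ∀ N : ℕ, ∃ A c : ℝ, 0 < A ∧ 0 < c ∧ ∀ t : ℝ, 0 ≤ t → |varianceChannel ω₂ lam β γ T N t| ≤ A * Real.exp (-c * t) := by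
  intro ω₂ lam β γ hω hl hβ hγ T hT N
  obtain ⟨A₁, c₁, hA₁, hc₁, h₁⟩ := powerCov_abs_le_exp ω₂ lam β γ hω hl hβ hγ T hT N
  obtain ⟨A₂, c₂, hA₂, hc₂, h₂⟩ := commonPast_abs_le_exp ω₂ lam β γ hω hl hβ hγ T hT N
  refine ⟨A₁ + A₂, min c₁ c₂, by positivity, lt_min hc₁ hc₂, fun t ht => ?_⟩
  have e₁ : Real.exp (-c₁ * t) ≤ Real.exp (-(min c₁ c₂) * t) :=
    Real.exp_le_exp.2 (by nlinarith [min_le_left c₁ c₂])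
  have e₂ : Real.exp (-c₂ * t) ≤ Real.exp (-(min c₁ c₂) * t) :=
    Real.exp_le_exp.2 (by nlinarith [min_le_right c₁ c₂])
  calc |varianceChannel ω₂ lam β γ T N t| = |powerCov ω₂ lam β γ T N t - commonPast ω₂ lam β γ T N t| := rfl
    _ ≤ |powerCov ω₂ lam β γ T N t| + |commonPast ω₂ lam β γ T N t| := abs_sub _ _
    _ ≤ A₁ * Real.exp (-c₁ * t) + A₂ * Real.exp (-c₂ * t) := add_le_add (h₁ t ht) (h₂ t ht)
    _ ≤ A₁ * Real.exp (-(min c₁ c₂) * t) + A₂ * Real.exp (-(min c₁ c₂) * t) :=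
        add_le_add (mul_le_mul_of_nonneg_left e₁ hA₁.le) (mul_le_mul_of_nonneg_left e₂ hA₂.le)
    _ = (A₁ + A₂) * Real.exp (-(min c₁ c₂) * t) := by ring

/-- **`C_N ∈ L¹(0, ∞)` for every `N`**: for all parameters `> 0` and `T > 0`, the power covariance
`t ↦ C_N(t) = Cov_{μ₀}(p₀², K_t p_N²)` is integrable on `(0, ∞)` at every fixed `N` — in substance the
integrability conjunct inside the conclusion of the sibling crux `BoundaryKubo` (stmt-AtomisticToContinuum-11812),
here from `IncoherentBounded.CN_integrableOn`. Registered helper for `stub_varianceTransport`.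
[cite: CuneoEckmannHairerReyBellet2018, Thm 2.13 (3)] -/
theorem powerCov_integrableOn : ∀ ω₂ lam β γ : ℝ, 0 < ω₂ → 0 < lam → 0 < β → 0 < γ → ∀ T : ℝ, 0 < T → ∀ N : ℕ, IntegrableOn (powerCov ω₂ lam β γ T N) (Ioi (0 : ℝ)) := by
  intro ω₂ lam β γ hω hl hβ hγ T hT N
  exact CN_integrableOn hω hl.le hβ hγ hT N

/-- **`P_N ∈ L¹(0, ∞)` for every `N`**: for all parameters `> 0` and `T > 0`, the common-past part
`t ↦ P_N(t) = Cov_{μ₀}(p₀², v_t²)` is integrable on `(0, ∞)` at every fixed `N` (measurable and dominated by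
`A e^{-ct}`). Registered helper for `stub_varianceTransport`. [cite: CuneoEckmannHairerReyBellet2018, Thm 2.13 (3)] -/
theorem commonPast_integrableOn : ∀ ω₂ lam β γ : ℝ, 0 < ω₂ → 0 < lam → 0 < β → 0 < γ → ∀ T : ℝ, 0 < T → ∀ N : ℕ, IntegrableOn (commonPast ω₂ lam β γ T N) (Ioi (0 : ℝ)) := by
  intro ω₂ lam β γ hω hl hβ hγ T hT N
  obtain ⟨A, c, -, hc, hb⟩ := commonPast_abs_le_exp ω₂ lam β γ hω hl hβ hγ T hT N
  refine Integrable.mono' ((exp_neg_integrableOn_Ioi 0 hc).const_mul A)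
    (varianceTransport_measurable_commonPast hω hl.le hβ.le hγ.le hT N).aestronglyMeasurable ?_
  refine (ae_restrict_iff' measurableSet_Ioi).2 (Eventually.of_forall fun t ht => ?_)
  rw [Real.norm_eq_abs]
  exact hb t (le_of_lt ht)

/-- **The fixed-`N` half of `stub_varianceTransport`: `B_N ∈ L¹(0, ∞)` for every `N`.** For all parameters
`> 0` and `T > 0`, the conditional-variance channel `t ↦ B_N(t) = C_N(t) - P_N(t) = Cov_{μ₀}(p₀², Var(p_N(t) | z))`
is integrable on `(0, ∞)` at every fixed `N` — exactly the first conjunct of the registered stub, from the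
exponential ergodicity of the equilibrium chain at fixed size. The second conjunct (the transport limit
`N(γ²/T²)∫₀^∞ B_N → κ > 0`, Fourier's law for the pinned anharmonic chain) is NOT addressed. Registered helper
for `stub_varianceTransport`. [cite: CuneoEckmannHairerReyBellet2018, Thm 2.13 (3)] -/
theorem varianceTransport_integrableOn : ∀ ω₂ lam β γ : ℝ, 0 < ω₂ → 0 < lam → 0 < β → 0 < γ → ∀ T : ℝ, 0 < T → ∀ N : ℕ, IntegrableOn (varianceChannel ω₂ lam β γ T N) (Ioi (0 : ℝ)) := by
  intro ω₂ lam β γ hω hl hβ hγ T hT N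
  exact (powerCov_integrableOn ω₂ lam β γ hω hl hβ hγ T hT N).sub
    (commonPast_integrableOn ω₂ lam β γ hω hl hβ hγ T hT N)

/-- **`stub_varianceTransport` is equivalent to its limit clause.** Given the transport limit
`N(γ²/T²)∫₀^∞ B_N → κ > 0` at every admissible parameter point (the open, transport-strength content of the
stub), the full registered statement follows, the integrability conjunct being `varianceTransport_integrableOn`.
[folklore] -/
theorem varianceTransport_of_limit
    (h : ∀ ω₂ lam β γ : ℝ, 0 < ω₂ → 0 < lam → 0 < β → 0 < γ → ∀ T : ℝ, 0 < T →
      ∃ κ : ℝ, 0 < κ ∧ Tendsto (fun N : ℕ => (N : ℝ) * (γ ^ 2 / T ^ 2) *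
        ∫ t in Ioi (0 : ℝ), varianceChannel ω₂ lam β γ T N t) atTop (𝓝 κ)) :
    ∀ ω₂ lam β γ : ℝ, 0 < ω₂ → 0 < lam → 0 < β → 0 < γ → ∀ T : ℝ, 0 < T →
      ∃ κ : ℝ, 0 < κ ∧ (∀ N : ℕ, IntegrableOn (varianceChannel ω₂ lam β γ T N) (Ioi (0 : ℝ))) ∧
        Tendsto (fun N : ℕ => (N : ℝ) * (γ ^ 2 / T ^ 2) *
          ∫ t in Ioi (0 : ℝ), varianceChannel ω₂ lam β γ T N t) atTop (𝓝 κ) := by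
  intro ω₂ lam β γ hω hl hβ hγ T hT
  obtain ⟨κ, hκ, hlim⟩ := h ω₂ lam β γ hω hl hβ hγ T hT
  exact ⟨κ, hκ, varianceTransport_integrableOn ω₂ lam β γ hω hl hβ hγ T hT, hlim⟩

end Summit.AtomisticToContinuum.FouriersLaw.Theorems.PhononMeanFreePath

end
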